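import Summits.Ventures.HodgeRepro2.TraceField

/-!
# The reflex field inside ℂ, and its stabiliser in Aut(ℂ)

Blind cell `pub-hodge-repro2`, seat p1 (Tier 4, sub-claim B4; also the B2 clause «h ∈ Aut(ℂ) fixes
M_μ pointwise ⟺ h ∘ Φ_μ = Φ_μ», T4-B2-p4.md B2.7(a) / T4-B4-p1.md Lemma B4.1 consequence).

For a finite set `Φ` of embeddings `K →+* ℂ` of a field `K` let
`complexTraceField Φ := ℚ(Σ_{φ ∈ Φ} φ ξ | ξ ∈ K) ⊂ ℂ` — Shimura's reflex field `K*` as a subfield of `ℂ`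
(Prop. 28, SOURCES S13.4) and Liu's `M_μ ⊆ ℂ` for `Φ = Φ_μ` (Def. 4.3(2)).  Then

* `mem_fixingSubgroup_complexTraceField_iff`: an automorphism `h ∈ Gal(ℂ/ℚ)` fixes `complexTraceField Φ`
  pointwise iff `h ∘ Φ = Φ` (post-composition) — both directions, by `TraceField.lean` (Dedekind), no
  power sums, no finiteness of `ℂ/ℚ` needed;
* `map_traceField`: for a Galois number field `K` and a base embedding `τ₀`, the complex trace field
  of `{τ₀ ∘ σ : σ ∈ S}` is the image under `τ₀` of the internal `traceField S` of `TraceField.lean`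
  (so Shimura's `K* ⊂ ℂ` is `τ₀(Fix(H*))`, the form used in T4-B4 Lemma B4.2).
-/

namespace Summit.Ventures.HodgeRepro2

open scoped Classical BigOperators

section Complex

variable {K : Type*} [Field K]

/-- Shimura's reflex field `K* = ℚ(Σ_i ξ^{φ_i} | ξ ∈ K)` of a finite set of complex embeddings, as an
intermediate field of `ℂ/ℚ`. -/
noncomputable def complexTraceField (Φ : Finset (K →+* ℂ)) : IntermediateField ℚ ℂ :=
  IntermediateField.adjoin ℚ (Set.range (typeTrace Φ))

/-- The traces generate the complex trace field. -/
theorem typeTrace_mem_complexTraceField (Φ : Finset (K →+* ℂ)) (ξ : K) :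
    typeTrace Φ ξ ∈ complexTraceField Φ :=
  IntermediateField.subset_adjoin ℚ _ ⟨ξ, rfl⟩

/-- An automorphism of `ℂ` fixing every trace of `Φ` fixes the whole trace field. -/
theorem mem_fixingSubgroup_complexTraceField_of_forall (Φ : Finset (K →+* ℂ)) (h : ℂ ≃ₐ[ℚ] ℂ)
    (hfix : ∀ ξ, h (typeTrace Φ ξ) = typeTrace Φ ξ) :
    h ∈ (complexTraceField Φ).fixingSubgroup := by
  rw [IntermediateField.mem_fixingSubgroup_iff]
  intro x hx
  have hle : complexTraceField Φ ≤ IntermediateField.fixedField (Subgroup.zpowers h) := by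
    refine IntermediateField.adjoin_le_iff.2 ?_
    rintro _ ⟨ξ, rfl⟩
    rw [SetLike.mem_coe, IntermediateField.mem_fixedField_iff]
    intro f hf
    obtain ⟨n, rfl⟩ := Subgroup.mem_zpowers_iff.1 hf
    refine zpow_induction_left (P := fun g : ℂ ≃ₐ[ℚ] ℂ => g (typeTrace Φ ξ) = typeTrace Φ ξ)
      ?_ ?_ ?_ n
    · simp
    · intro g hg
      rw [AlgEquiv.mul_apply, hg, hfix]
    · intro g hg
      rw [AlgEquiv.mul_apply, hg]
      conv_lhs => rw [← hfix ξ]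
      rw [← AlgEquiv.mul_apply, inv_mul_cancel, AlgEquiv.one_apply]
  have := hle hx
  rw [IntermediateField.mem_fixedField_iff] at this
  exact this h (Subgroup.mem_zpowers h)

/-- **The two-sided reflex-field clause** (T4-B2 B2.7(a) / T4-B4 Lemma B4.1, consequence): an
automorphism `h` of `ℂ` fixes the reflex field `ℚ(traces of Φ)` pointwise if and only if it stabilises
`Φ` under post-composition, `h ∘ Φ = Φ`. -/
theorem mem_fixingSubgroup_complexTraceField_iff (Φ : Finset (K →+* ℂ)) (h : ℂ ≃ₐ[ℚ] ℂ) :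
    h ∈ (complexTraceField Φ).fixingSubgroup ↔
      (Φ.image fun φ => (h : ℂ →+* ℂ).comp φ) = Φ := by
  constructor
  · intro hh
    refine image_comp_eq_of_forall_map_typeTrace_eq (h : ℂ →+* ℂ) Φ fun ξ => ?_
    rw [IntermediateField.mem_fixingSubgroup_iff] at hh
    exact hh _ (typeTrace_mem_complexTraceField Φ ξ)
  · intro hΦ
    exact mem_fixingSubgroup_complexTraceField_of_forall Φ h
      (forall_map_typeTrace_eq_of_image_comp_eq (h : ℂ →+* ℂ) Φ hΦ)

end Complex

section Galois

variable {K : Type*} [Field K] [NumberField K] [IsGalois ℚ K]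

/-- Through a base embedding `τ₀`, Shimura's complex reflex field of `{τ₀ ∘ σ : σ ∈ S}` is the image
of the internal trace field `traceField S` (= `Fix(H*)`, `traceField_eq_fixedField_typeStabilizer`). -/
theorem map_traceField (τ₀ : K →+* ℂ) (S : Finset Gal(K/ℚ)) :
    (traceField K S).map τ₀.toRatAlgHom = complexTraceField (S.image (galEmb K τ₀)) := by
  unfold traceField complexTraceField
  rw [IntermediateField.adjoin_map]
  congr 1
  ext z
  constructor
  · rintro ⟨_, ⟨ξ, rfl⟩, rfl⟩
    exact ⟨ξ, by rw [typeTrace_image_galEmb]; rfl⟩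
  · rintro ⟨ξ, rfl⟩
    exact ⟨internalTrace K S ξ, ⟨ξ, rfl⟩, by rw [typeTrace_image_galEmb]; rfl⟩

/-- Consequently `[K* : ℚ] = [Fix(H*) : ℚ] = [K : ℚ] / |H*|` is read off the Galois group. -/
theorem finrank_complexTraceField (τ₀ : K →+* ℂ) (S : Finset Gal(K/ℚ)) :
    Module.finrank ℚ (complexTraceField (S.image (galEmb K τ₀))) =
      Module.finrank ℚ (traceField K S) := by
  rw [← map_traceField]
  exact (IntermediateField.equivMap (traceField K S) τ₀.toRatAlgHom).symm.toLinearEquiv.finrank_eq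

end Galois

end Summit.Ventures.HodgeRepro2
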